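import Literature.NumberTheory.EllipticCurves.Wuthrich2014.SurjectiveDivisibilityCyclotomicPrimeHalf
import Literature.NumberTheory.EllipticCurves.Kato2004.BigImageDivisibilityCyclotomicPrimeComponent
import HarnessLib

/-!
# Kato 2004 Thm. 17.4 (3), component `(p−1)/2`, GOOD ORDINARY big-image inline-datum form (A124)
# `Kato2004.charIdeal_dvd_padicLFunctionBranch_component_of_surjective` — DERIVED from the semistable
# big-image component reading `Wuthrich2014.kato_halfEigenCharIdeal_dvd_cyclotomicPrime_of_surjective`
# (NO named fact in this file; kernel consistency check)

Source: K. Kato, *`p`-adic Hodge theory and values of zeta functions of modular forms*, Astérisque 295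
(2004) [Kato2004Asterisque], Theorem 17.4 (3) (p. 273) with §17.3, (12.5.2) (p. 222); C. Wuthrich,
Doc. Math. 19 (2014) [Wuthrich2014], §3 (p. 390: "we split `M` up into the eigenspaces
`M = ⊕_{i=0}^{p−2} M_i`"), Thm. 3 / Cor. 19; see the two module docstrings for the full reading.

The cell `b2b-bsdres` holds TWO transcriptions of the SAME printed sentence on the component
`m = (p−1)/2` at a good ordinary `p` under `ρ_{E,p^∞}` onto: additive-p2's
`Kato2004.charIdeal_dvd_padicLFunctionBranch_component_of_surjective` (A124; the eigen-Selmer datum INLINED as an `AddSubgroup S` with a membership characterisation, a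
module `X` and a bijection `toDual` with its `T`- and `C`-identities) and additive-p1's
`Wuthrich2014.kato_halfEigenCharIdeal_dvd_cyclotomicPrime_of_surjective` (the SEMISTABLE big-image
reading in the Literature structure `WeierstrassCurve.EigenSelmerDualData`, whose first disjunct is
Kato 17.4 (3) at a good ordinary `p`). Literature-seat
ruling C169 (2026-08-20) asked for the kernel derivation of the former from the latter, so that the
referee may retire the special case by migrating its consumers. THIS FILE is that derivation: the
inline subgroup `S` EQUALS `eigenSelmerGroupOver V p H (ker κ) χ_K` (`AddSubgroup.ext` on the
membership characterisation; `(if g ∈ galRange K then 1 else −1) • t = if … then t else −t`), after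
`subst` the inline data ARE an `EigenSelmerDualData`, and the general fact's good-ordinary disjunct is
the claim. ONE theorem, no `def`, no new assertion (debt 0).
-/

set_option autoImplicit false

noncomputable section

open scoped Classical MatrixGroups ModularForm

open CongruenceSubgroup WeierstrassCurve Literature.NumberTheory.EllipticCurves
  Literature.NumberTheory.EllipticCurves.ModularForms
  Literature.NumberTheory.GaloisRepresentations

namespace Literature.NumberTheory.EllipticCurves.Kato2004

/-- **A124 from the semistable big-image component reading.** Kato 2004 Thm. 17.4 (3) (Astérisque
295, p. 273: "`length_{Λ_𝔭}(X(T)_𝔭) ≤ ord_𝔭(L_{p-adic,α,ω,γ}(f))` for any prime ideal `𝔭` of `Λ` of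
height one", under (12.5.2)), component `m = (p−1)/2` (Wuthrich §3 p. 390), good ordinary `p`, in
additive-p2's inline-datum form `charIdeal_dvd_padicLFunctionBranch_component_of_surjective`, follows
from `Wuthrich2014.kato_halfEigenCharIdeal_dvd_cyclotomicPrime_of_surjective`: the inline
eigen-subgroup `S` is
`eigenSelmerGroupOver V p (ker κ ⊓ galRange K ⊓ galRange F) (ker κ) χ_K` by extensionality, the inline
`(X, toDual, …)` is then an `EigenSelmerDualData`, and the good-ordinary disjunct of the general fact
(branch `padicLFunction[Minus]Branch f (unitRoot V p) (p/2)` by parity) is the conclusion. Kernel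
consistency check between two transcriptions of the same sentence; no new assertion.
[cite: Kato2004Asterisque, Thm. 17.4 (3) (p. 273) with §17.3 and (12.5.2) (p. 222)]
[cite: Wuthrich2014, §3 (p. 390), Thm. 3 (p. 383), Cor. 19 (p. 398)] -/
theorem charIdeal_dvd_padicLFunctionBranch_component_of_surjective_of_half
    (h : Wuthrich2014.kato_halfEigenCharIdeal_dvd_cyclotomicPrime_of_surjective) :
    charIdeal_dvd_padicLFunctionBranch_component_of_surjective := by
  intro p _ V _ _ K _ _ _ F _ _ _ _ κ γ N _ f S hSγ X _ _ toDual hp2 h2 hθ hord hsurj hκ hγ hcyc hγK hγF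
    hf hS hbij hT hC ϖ hϖ
  -- the inline subgroup is the Literature eigen-Selmer group
  obtain rfl : S = V.eigenSelmerGroupOver p
      (κ.kerSubgroup ⊓ galRange (K := ℚ) K ⊓ galRange (K := ℚ) F) κ.kerSubgroup
      (fun g ↦ if g ∈ galRange (K := ℚ) K then 1 else -1) := by
    ext t
    rw [hS t, mem_eigenSelmerGroupOver_iff]
    refine and_congr_right fun _ ↦ ⟨fun H g ↦ ?_, fun H g hg ↦ ?_⟩
    · rw [H g g.2]
      split_ifs <;> simp
    · rw [H ⟨g, hg⟩]
      simp only
      split_ifs <;> simp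
  -- the inline data are an eigen dual datum
  let D : V.EigenSelmerDualData p (κ.kerSubgroup ⊓ galRange (K := ℚ) K ⊓ galRange (K := ℚ) F)
      κ.kerSubgroup (fun g ↦ if g ∈ galRange (K := ℚ) K then 1 else -1) γ :=
    { X := X, conj_mem := hSγ, toDual := toDual, bijective := hbij, toDual_T_smul := hT,
      toDual_C_smul := hC }
  exact h p V K F _ hp2 h2 hθ (Or.inl ⟨hord, rfl⟩) hsurj hκ hγ hcyc hγK hγF hf D ϖ hϖ

end Literature.NumberTheory.EllipticCurves.Kato2004

end
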